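import Summits.HodgeConjecture.CorCM.IrreducibleOddWeightsIsotypicFrobeniusOrbits
import HarnessLib

/-!
# Isotypic cells, Frobenius X: REGULAR-TYPE SLOTS — if the stabiliser of one point fixes the slot pointwise
# (e.g. `Hom(K, ℂ)` for `K/ℚ` Galois), every occurring class has its REGULAR multiplicity: `m_c·δ_c = dim A_c`

COR-CM (cell `pub-hodgecm2`, binder seat `b16` gen 77, count-neutral claim FROBENIUS RECIPROCITY IN THE REFERENCE
CURRENCY — MULTIPLICITIES FROM FIXED POINTS, file R10; theorems only, no definition, no named fact, no `sorry`).
NEW as stated, hence under `Summits/`.  HONEST FRAMING: finite-dimensional linear algebra.  A transitive slot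
`Y₀ ∋ x₀` is of REGULAR TYPE when `Stab(x₀)` fixes `Y₀` pointwise (all point stabilisers coincide — `Y₀ ≅ G/N`
with `N` normal; for number fields: all embeddings `K → ℂ` have the same image, e.g. `K/ℚ` Galois).  Then the
`Stab(x₀)`-orbits on `Y₀` are singletons, so the Hecke count of file R9 reads `Σ_c m_c²·δ_c = |Y₀| = Σ_c m_c·dim A_c`
(gen 76 E5), and with the termwise bound `m_c·δ_c ≤ dim A_c` of file R6 every OCCURRING class (`m_c ≠ 0`) has
**`m_c·δ_c = dim A_c`** — the multiplicity `dim A_c/δ_c` of `A_c` in the regular representation, now for the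
permutation module itself (file R3's `…_of_free` needed the stabiliser to act trivially on the reference ambient;
here only on the slot).  Nothing about Hodge classes is asserted; `HC_CM` is neither used nor asserted.

* §1 `card_orbitRel_quotient_eq_card_of_forall_fix` (`#(Stab(x₀)\Y₀) = |Y₀|` for a regular-type slot).
* §2 **`card_mul_finrank_eq_finrank_of_forall_fix`** (M-series data, one slot): `|J_c| ≠ 0 ⟹ |J_c|·δ_c = dim A_c`;
  `sum_card_sq_mul_eq_card_of_forall_fix` (`Σ_c |J_c|²·δ_c = |Y₀|`).
* §3 `exists_isotypic_card_mul_eq_finrank_of_forall_fix` (no input but the slots);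
  **`exists_isotypic_card_mul_eq_finrank_of_same_range`** (number fields `K_i` all of whose complex embeddings
  have the same image: every `Aut(ℂ)`-irreducible occurring in `ℚ^{Hom(K_i, ℂ)}` occurs `dim A_c/δ_c` times).

## References

* [Serre1977] J.-P. Serre, *Linear Representations of Finite Groups*, GTM 42, §2.4 (the regular representation:
  each irreducible occurs with multiplicity its degree — over `ℚ`: `dim A/δ`), §12.1, §7.2 Ex. 7.2–7.3.
* [LangeRodriguez2022] H. Lange, R. E. Rodríguez, *Decomposition of Jacobians by Prym Varieties*, LNM 2310 (2022),
  §2.8 (2.21)–(2.23) and Lemma 2.8.1.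
-/

set_option autoImplicit false

noncomputable section

open scoped BigOperators Classical

universe u uC uJ v vC w

namespace Summit.HodgeConjecture.CorCM.IrrOdd

variable {G : Type w} [Group G]

/-! ### §1 A regular-type slot: the stabiliser's orbits are singletons -/

section Orbits

variable {Y₀ : Type v} [MulAction G Y₀] [Fintype Y₀]

/-- **`#(Stab(x₀)\Y₀) = |Y₀|` when `Stab(x₀)` fixes `Y₀` pointwise** (the orbit map is a bijection).
[cite: Serre1977, §7.2 Ex. 7.2] -/
theorem card_orbitRel_quotient_eq_card_of_forall_fix {x₀ : Y₀}
    (hfix : ∀ k : G, k • x₀ = x₀ → ∀ y : Y₀, k • y = y) :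
    Fintype.card (MulAction.orbitRel.Quotient (MulAction.stabilizer G x₀) Y₀) = Fintype.card Y₀ := by
  set H : Subgroup G := MulAction.stabilizer G x₀ with hH
  let mk : Y₀ → MulAction.orbitRel.Quotient H Y₀ := Quotient.mk''
  have hsurj : Function.Surjective mk := fun q => Quotient.inductionOn' q fun y => ⟨y, rfl⟩
  have hinj : Function.Injective mk := by
    intro y y' h
    have h' : y ∈ MulAction.orbit H y' := Quotient.exact' h
    obtain ⟨k, hk⟩ := MulAction.mem_orbit_iff.1 h'
    rw [← hk]
    exact hfix (k : G) (MulAction.mem_stabilizer_iff.1 k.2) y'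
  exact (Fintype.card_of_bijective ⟨hinj, hsurj⟩).symm

end Orbits

/-! ### §2 Regular multiplicities -/

section Regular

variable {Y₀ : Type v} [MulAction G Y₀] [Fintype Y₀] {C : Type uC} [Fintype C] {Yc : C → Type vC}
  [∀ c, MulAction G (Yc c)] [∀ c, Fintype (Yc c)] {Ar : ∀ c, Submodule ℚ (Yc c → ℚ)}
  {𝒟 : ∀ c, Submodule ℚ ((Yc c → ℚ) →ₗ[ℚ] (Yc c → ℚ))} {JJ : C → Type uJ} [∀ c, Fintype (JJ c)]

/-- **`Σ_c |J_c|²·δ_c = |Y₀|` for a regular-type slot** (file R9's Hecke count with singleton orbits).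
[cite: Serre1977, §7.2 Ex. 7.2–7.3] [cite: LangeRodriguez2022, §2.8 Lemma 2.8.1] -/
theorem sum_card_sq_mul_eq_card_of_forall_fix
    (h𝒟 : ∀ c (L : (Yc c → ℚ) →ₗ[ℚ] (Yc c → ℚ)), L ∈ 𝒟 c ↔ (∀ a ∈ Ar c, L a ∈ Ar c) ∧
      ∀ (k : G) (a : Yc c → ℚ), a ∈ Ar c → L (fun y => a (k • y)) = fun y => L a (k • y))
    (hRst : ∀ c (k : G) (a : Yc c → ℚ), a ∈ Ar c → (fun y => a (k • y)) ∈ Ar c)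
    (hRirr : ∀ c (W : Submodule ℚ (Yc c → ℚ)), W ≤ Ar c → W ≠ ⊥ →
      (∀ (k : G) (f : Yc c → ℚ), f ∈ W → (fun y => f (k • y)) ∈ W) → W = Ar c)
    (hsep : ∀ c c' (L : (Yc c → ℚ) →ₗ[ℚ] (Yc c' → ℚ)), c ≠ c' → Ar c ≠ ⊥ → (∀ a ∈ Ar c, L a ∈ Ar c') →
      (∀ a ∈ Ar c, L a = 0 → a = 0) →
      (∀ (k : G) (a : Yc c → ℚ), a ∈ Ar c → L (fun y => a (k • y)) = fun y => L a (k • y)) → False)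
    (ι : ∀ c, JJ c → ((Yc c → ℚ) →ₗ[ℚ] (Y₀ → ℚ)))
    (hιeq : ∀ c (j : JJ c) (k : G) (a : Yc c → ℚ), a ∈ Ar c →
      ι c j (fun y => a (k • y)) = fun y => ι c j a (k • y))
    (hinj : ∀ c (j : JJ c) (a : Yc c → ℚ), a ∈ Ar c → ι c j a = 0 → a = 0)
    (hindep : iSupIndep fun q : (Σ c, JJ c) => (Ar q.1).map (ι q.1 q.2))
    (htop : (⨆ c, ⨆ j, (Ar c).map (ι c j)) = ⊤)
    {a₀ : ∀ c, Yc c → ℚ} (ha₀ : ∀ c, a₀ c ∈ Ar c) (h0 : ∀ c, a₀ c ≠ 0)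
    {x₀ : Y₀} (htr : ∀ x : Y₀, ∃ g : G, g • x₀ = x) (hfix : ∀ k : G, k • x₀ = x₀ → ∀ y : Y₀, k • y = y) :
    ∑ c, Fintype.card (JJ c) ^ 2 * Module.finrank ℚ ↥((𝒟 c).map (LinearMap.applyₗ (a₀ c))) = Fintype.card Y₀ := by
  rw [← card_orbitRel_quotient_eq_sum_sq h𝒟 hRst hRirr hsep ι hιeq hinj hindep htop ha₀ h0 htr,
    card_orbitRel_quotient_eq_card_of_forall_fix hfix]

/-- **REGULAR MULTIPLICITIES: `|J_c| ≠ 0 ⟹ |J_c|·δ_c = dim A_c` on a regular-type slot** — every class that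
occurs in the permutation module occurs `dim A_c/δ_c` times (`Σ_c |J_c|·(|J_c|·δ_c) = |Y₀| = Σ_c |J_c|·dim A_c` with
`|J_c|·δ_c ≤ dim A_c` termwise, file R6). [cite: Serre1977, §2.4 and §12.1] [cite: LangeRodriguez2022, §2.8 (2.21)–(2.23)] -/
theorem card_mul_finrank_eq_finrank_of_forall_fix
    (h𝒟 : ∀ c (L : (Yc c → ℚ) →ₗ[ℚ] (Yc c → ℚ)), L ∈ 𝒟 c ↔ (∀ a ∈ Ar c, L a ∈ Ar c) ∧
      ∀ (k : G) (a : Yc c → ℚ), a ∈ Ar c → L (fun y => a (k • y)) = fun y => L a (k • y))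
    (hRst : ∀ c (k : G) (a : Yc c → ℚ), a ∈ Ar c → (fun y => a (k • y)) ∈ Ar c)
    (hRirr : ∀ c (W : Submodule ℚ (Yc c → ℚ)), W ≤ Ar c → W ≠ ⊥ →
      (∀ (k : G) (f : Yc c → ℚ), f ∈ W → (fun y => f (k • y)) ∈ W) → W = Ar c)
    (hsep : ∀ c c' (L : (Yc c → ℚ) →ₗ[ℚ] (Yc c' → ℚ)), c ≠ c' → Ar c ≠ ⊥ → (∀ a ∈ Ar c, L a ∈ Ar c') →
      (∀ a ∈ Ar c, L a = 0 → a = 0) →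
      (∀ (k : G) (a : Yc c → ℚ), a ∈ Ar c → L (fun y => a (k • y)) = fun y => L a (k • y)) → False)
    (ι : ∀ c, JJ c → ((Yc c → ℚ) →ₗ[ℚ] (Y₀ → ℚ)))
    (hιeq : ∀ c (j : JJ c) (k : G) (a : Yc c → ℚ), a ∈ Ar c →
      ι c j (fun y => a (k • y)) = fun y => ι c j a (k • y))
    (hinj : ∀ c (j : JJ c) (a : Yc c → ℚ), a ∈ Ar c → ι c j a = 0 → a = 0)
    (hindep : iSupIndep fun q : (Σ c, JJ c) => (Ar q.1).map (ι q.1 q.2))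
    (htop : (⨆ c, ⨆ j, (Ar c).map (ι c j)) = ⊤)
    {a₀ : ∀ c, Yc c → ℚ} (ha₀ : ∀ c, a₀ c ∈ Ar c) (h0 : ∀ c, a₀ c ≠ 0)
    {x₀ : Y₀} (htr : ∀ x : Y₀, ∃ g : G, g • x₀ = x) (hfix : ∀ k : G, k • x₀ = x₀ → ∀ y : Y₀, k • y = y)
    (c : C) (hc : Fintype.card (JJ c) ≠ 0) :
    Fintype.card (JJ c) * Module.finrank ℚ ↥((𝒟 c).map (LinearMap.applyₗ (a₀ c))) = Module.finrank ℚ (Ar c) := by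
  have hsum := sum_card_sq_mul_eq_card_of_forall_fix h𝒟 hRst hRirr hsep ι hιeq hinj hindep htop ha₀ h0 htr hfix
  rw [card_eq_sum_card_mul_finrank ι hinj hindep htop] at hsum
  -- termwise `|J_c|·(|J_c|·δ_c) ≤ |J_c|·dim A_c`
  have hle : ∀ c' ∈ (Finset.univ : Finset C),
      Fintype.card (JJ c') ^ 2 * Module.finrank ℚ ↥((𝒟 c').map (LinearMap.applyₗ (a₀ c'))) ≤
        Fintype.card (JJ c') * Module.finrank ℚ (Ar c') := by
    intro c' _
    rw [sq, mul_assoc]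
    exact Nat.mul_le_mul_left _ (card_mul_finrank_map_applyₗ_le_finrank (h𝒟 c') hRst hRirr hsep ι hιeq (hinj c')
      hindep htop (ha₀ c') (h0 c') htr)
  have heq := (Finset.sum_eq_sum_iff_of_le hle).1 hsum c (Finset.mem_univ c)
  rw [sq, mul_assoc] at heq
  exact Nat.eq_of_mul_eq_mul_left (Nat.pos_of_ne_zero hc) heq

end Regular

/-! ### §3 With no input but the slots; number fields with a common image of the embeddings -/

section NoInput

variable {I : Type u} {E : I → Type v} [∀ i, MulAction G (E i)] [∀ i, Fintype (E i)] [Fintype I]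

/-- **REGULAR MULTIPLICITIES WITH NO INPUT BUT THE SLOTS**: for finite `G`-sets `E_i` and the isotypic decomposition
of gen 76 E3, on every slot `E_i` transitive from `x₀` whose stabiliser fixes `E_i` pointwise, every occurring class
has `m_{i,c}·δ_c = dim A_c`. [cite: Serre1977, §2.4 and §12.1] [cite: LangeRodriguez2022, §2.8 (2.21)–(2.23)] -/
theorem exists_isotypic_card_mul_eq_finrank_of_forall_fix :
    ∃ (n : ℕ) (Ar : Fin n → Submodule ℚ ((Σ i, E i) → ℚ))
      (𝒟 : Fin n → Submodule ℚ (((Σ i, E i) → ℚ) →ₗ[ℚ] ((Σ i, E i) → ℚ))) (m : I → Fin n → ℕ)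
      (ι : ∀ (i : I) (c : Fin n), Fin (m i c) → (((Σ i, E i) → ℚ) →ₗ[ℚ] (E i → ℚ)))
      (a₀ : Fin n → ((Σ i, E i) → ℚ)),
      (∀ (c : Fin n) (L : ((Σ i, E i) → ℚ) →ₗ[ℚ] ((Σ i, E i) → ℚ)), L ∈ 𝒟 c ↔ (∀ a ∈ Ar c, L a ∈ Ar c) ∧
        ∀ (k : G) (a : (Σ i, E i) → ℚ), a ∈ Ar c → L (fun x => a (k • x)) = fun x => L a (k • x)) ∧
      (∀ (c : Fin n) (k : G) (a : (Σ i, E i) → ℚ), a ∈ Ar c → (fun x => a (k • x)) ∈ Ar c) ∧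
      (∀ (c : Fin n) (W : Submodule ℚ ((Σ i, E i) → ℚ)), W ≤ Ar c → W ≠ ⊥ →
        (∀ (k : G) (f : (Σ i, E i) → ℚ), f ∈ W → (fun x => f (k • x)) ∈ W) → W = Ar c) ∧
      (∀ c : Fin n, Ar c ≠ ⊥) ∧
      (∀ (c c' : Fin n) (L : ((Σ i, E i) → ℚ) →ₗ[ℚ] ((Σ i, E i) → ℚ)), c ≠ c' → Ar c ≠ ⊥ →
        (∀ a ∈ Ar c, L a ∈ Ar c') → (∀ a ∈ Ar c, L a = 0 → a = 0) →
        (∀ (k : G) (a : (Σ i, E i) → ℚ), a ∈ Ar c → L (fun x => a (k • x)) = fun x => L a (k • x)) →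
        False) ∧
      (∀ (i : I) (c : Fin n) (j : Fin (m i c)) (k : G) (a : (Σ i, E i) → ℚ), a ∈ Ar c →
        ι i c j (fun x => a (k • x)) = fun s => ι i c j a (k • s)) ∧
      (∀ (i : I) (c : Fin n) (j : Fin (m i c)) (a : (Σ i, E i) → ℚ), a ∈ Ar c → ι i c j a = 0 → a = 0) ∧
      (∀ i : I, iSupIndep fun q : (Σ c : Fin n, Fin (m i c)) => (Ar q.1).map (ι i q.1 q.2)) ∧
      (∀ i : I, (⨆ c : Fin n, ⨆ j : Fin (m i c), (Ar c).map (ι i c j)) = ⊤) ∧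
      (∀ c, a₀ c ∈ Ar c) ∧ (∀ c, a₀ c ≠ 0) ∧
      ∀ (i : I) (x₀ : E i), (∀ x : E i, ∃ g : G, g • x₀ = x) → (∀ k : G, k • x₀ = x₀ → ∀ y : E i, k • y = y) →
        ∀ c, m i c ≠ 0 →
          m i c * Module.finrank ℚ ↥((𝒟 c).map (LinearMap.applyₗ (a₀ c))) = Module.finrank ℚ (Ar c) := by
  obtain ⟨n, Ar, m, ι, hRst, hRirr, hR0, hsep, hιeq, hind, hindep, htop, -⟩ :=
    exists_isotypic_decomposition (G := G) (E := E)
  obtain ⟨𝒟, h𝒟⟩ := exists_commutants (G := G) Ar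
  obtain ⟨a₀, ha₀, h0⟩ := exists_mem_ne_zero_of_forall_ne_bot hR0
  have hinj : ∀ (i : I) (c : Fin n) (j : Fin (m i c)) (a : (Σ i, E i) → ℚ), a ∈ Ar c → ι i c j a = 0 → a = 0 :=
    fun i c j a ha hz => injOn_of_jointly_independent (ι i c) (hind i c) j a ha hz
  refine ⟨n, Ar, 𝒟, m, ι, a₀, h𝒟, hRst, hRirr, hR0, hsep, hιeq, hinj, hindep, htop, ha₀, h0,
    fun i x₀ htr hfix c hc => ?_⟩
  have hc' : Fintype.card (Fin (m i c)) ≠ 0 := by rwa [Fintype.card_fin]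
  have h1 := card_mul_finrank_eq_finrank_of_forall_fix (Yc := fun _ : Fin n => Σ i, E i)
    (JJ := fun c => Fin (m i c)) h𝒟 hRst hRirr hsep (ι i) (hιeq i) (hinj i) (hindep i) (htop i) ha₀ h0 htr hfix
    c hc'
  simpa only [Fintype.card_fin] using h1

end NoInput

end Summit.HodgeConjecture.CorCM.IrrOdd

namespace Summit.HodgeConjecture.CorCM

open NumberField
open Literature.NumberTheory.ComplexMultiplication
open Literature.AlgebraicGeometry.Pohlmann1968

variable {I : Type} [Fintype I] {K : I → Type} [∀ i, Field (K i)] [∀ i, NumberField (K i)]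

omit [Fintype I] [∀ i, NumberField (K i)] in
/-- If all complex embeddings of `K` have the same image, the stabiliser of one fixes them all. [folklore] -/
theorem smul_eq_of_same_range {i : I} (hgal : ∀ (x y : K i →+* ℂ) (a : K i), y a ∈ Set.range x)
    (k : ℂ ≃+* ℂ) (x : K i →+* ℂ) (hk : k • x = x) (y : K i →+* ℂ) : k • y = y := by
  rw [smul_embedding_eq_self_iff] at hk ⊢
  intro a
  obtain ⟨b, hb⟩ := hgal x y a
  rw [← hb, hk b]

/-- **A NUMBER FIELD WHOSE COMPLEX EMBEDDINGS HAVE A COMMON IMAGE (E.G. `K/ℚ` GALOIS) HAS REGULAR MULTIPLICITIES**: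
for number fields `K_i` there is an `Aut(ℂ)`-isotypic decomposition `ℚ^{Hom(K_i, ℂ)} ≅ ⊕_c A_c^{m_{i,c}}` (commutants
`𝒟_c`, non-zero `a₀_c`, `δ_c = dim 𝒟_c·a₀_c`) such that for every `i` with `y(K_i) ⊆ x(K_i)` for all embeddings
`x, y`, **every occurring class has `m_{i,c}·δ_c = dim A_c`** (its multiplicity in the regular representation of
the Galois group). [cite: Serre1977, §2.4 and §12.1] [cite: LangeRodriguez2022, §2.8 (2.21)–(2.23)] -/
theorem exists_isotypic_card_mul_eq_finrank_of_same_range :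
    ∃ (n : ℕ) (Ar : Fin n → Submodule ℚ ((Σ i, (K i →+* ℂ)) → ℚ))
      (𝒟 : Fin n → Submodule ℚ (((Σ i, (K i →+* ℂ)) → ℚ) →ₗ[ℚ] ((Σ i, (K i →+* ℂ)) → ℚ)))
      (m : I → Fin n → ℕ)
      (ι : ∀ (i : I) (c : Fin n), Fin (m i c) → (((Σ i, (K i →+* ℂ)) → ℚ) →ₗ[ℚ] ((K i →+* ℂ) → ℚ)))
      (a₀ : Fin n → ((Σ i, (K i →+* ℂ)) → ℚ)),
      (∀ (c : Fin n) (L : ((Σ i, (K i →+* ℂ)) → ℚ) →ₗ[ℚ] ((Σ i, (K i →+* ℂ)) → ℚ)), L ∈ 𝒟 c ↔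
        (∀ a ∈ Ar c, L a ∈ Ar c) ∧ ∀ (k : ℂ ≃+* ℂ) (a : (Σ i, (K i →+* ℂ)) → ℚ), a ∈ Ar c →
          L (fun x => a (k • x)) = fun x => L a (k • x)) ∧
      (∀ (c : Fin n) (k : ℂ ≃+* ℂ) (a : (Σ i, (K i →+* ℂ)) → ℚ), a ∈ Ar c → (fun x => a (k • x)) ∈ Ar c) ∧
      (∀ (c : Fin n) (W : Submodule ℚ ((Σ i, (K i →+* ℂ)) → ℚ)), W ≤ Ar c → W ≠ ⊥ →
        (∀ (k : ℂ ≃+* ℂ) (f : (Σ i, (K i →+* ℂ)) → ℚ), f ∈ W → (fun x => f (k • x)) ∈ W) → W = Ar c) ∧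
      (∀ c : Fin n, Ar c ≠ ⊥) ∧
      (∀ (c c' : Fin n) (L : ((Σ i, (K i →+* ℂ)) → ℚ) →ₗ[ℚ] ((Σ i, (K i →+* ℂ)) → ℚ)), c ≠ c' → Ar c ≠ ⊥ →
        (∀ a ∈ Ar c, L a ∈ Ar c') → (∀ a ∈ Ar c, L a = 0 → a = 0) →
        (∀ (k : ℂ ≃+* ℂ) (a : (Σ i, (K i →+* ℂ)) → ℚ), a ∈ Ar c →
          L (fun x => a (k • x)) = fun x => L a (k • x)) → False) ∧
      (∀ (i : I) (c : Fin n) (j : Fin (m i c)) (k : ℂ ≃+* ℂ) (a : (Σ i, (K i →+* ℂ)) → ℚ), a ∈ Ar c →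
        ι i c j (fun x => a (k • x)) = fun s => ι i c j a (k • s)) ∧
      (∀ (i : I) (c : Fin n) (j : Fin (m i c)) (a : (Σ i, (K i →+* ℂ)) → ℚ), a ∈ Ar c →
        ι i c j a = 0 → a = 0) ∧
      (∀ i : I, iSupIndep fun q : (Σ c : Fin n, Fin (m i c)) => (Ar q.1).map (ι i q.1 q.2)) ∧
      (∀ i : I, (⨆ c : Fin n, ⨆ j : Fin (m i c), (Ar c).map (ι i c j)) = ⊤) ∧
      (∀ c, a₀ c ∈ Ar c) ∧ (∀ c, a₀ c ≠ 0) ∧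
      ∀ i : I, (∀ (x y : K i →+* ℂ) (a : K i), y a ∈ Set.range x) → ∀ c, m i c ≠ 0 →
        m i c * Module.finrank ℚ ↥((𝒟 c).map (LinearMap.applyₗ (a₀ c))) = Module.finrank ℚ (Ar c) := by
  haveI : ∀ i, Nonempty (K i →+* ℂ) := fun i => inferInstance
  obtain ⟨n, Ar, 𝒟, m, ι, a₀, h𝒟, hRst, hRirr, hR0, hsep, hιeq, hinj, hindep, htop, ha₀, h0, hreg⟩ :=
    IrrOdd.exists_isotypic_card_mul_eq_finrank_of_forall_fix (G := ℂ ≃+* ℂ) (E := fun i => K i →+* ℂ)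
  refine ⟨n, Ar, 𝒟, m, ι, a₀, h𝒟, hRst, hRirr, hR0, hsep, hιeq, hinj, hindep, htop, ha₀, h0, fun i hgal c hc => ?_⟩
  obtain ⟨x₀⟩ := (inferInstance : Nonempty (K i →+* ℂ))
  exact hreg i x₀ (exists_smul_embedding_eq x₀) (fun k hk y => smul_eq_of_same_range hgal k x₀ hk y) c hc

end Summit.HodgeConjecture.CorCM

end
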